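import Summits.Ventures.PercRepro.C025ProfileSplit

/-!
# C-032 «PROFILE (Π)» — the parallel-pair step of the row `q = 1` (night-3 g6)

`profileIneq_one_of_delete_parallel`: for a loopless finite matroid `M` with a parallel pair `e ∥ f`
(`f ∈ E`, `f ≠ e`, `e ∈ cl {f}`), `(Π_{1,u+1})` on `M ＼ {e}` implies `(Π_{1,u+1})` on `M`.

Proof (dossier §8′). Write `E' = E ∖ {e}`. The rank-`1` sets of `M` split into those avoiding `e`
(= the rank-`1` sets of `M ＼ {e}`) and `insert e B'` for the rank-`0` sets `B'` of `M ／ {e}`;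
the level `#levelSet M (u+1)` splits likewise (`card_levelSet_of_indep_singleton`). Per set:
* `e ∈ cl(E' ∖ B)` ⇒ `price_M B = price_{M＼e} B` (`price_eq_price_delete_of_mem_closure`);
  `e ∉ cl(E' ∖ B)` forces `B = parClass M e`, the parallel class of `e` (`eq_parClass_of_eRk_one`);
* always `price_M (insert e B') ≤ price_{M／e} B'` at levels `u+1` / `u` (`price_insert_le_price_contract`,
  from `P1 r (u+1) ≤ P0 (r-1) u`);
* at the parallel class, `price_M P + price_M (insert e P) ≤ price_{M＼e} P + price_{M／e} P` (`price_pair_le`).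
Summing, with `(Π_{1,u+1})(M ＼ e)` and `profileIneq_zero (M ／ e) u`, gives `(Π_{1,u+1})(M)`.
-/

open scoped Matroid

namespace PercRepro

open Set Finset ThmH

section Parallel

variable {α : Type} [DecidableEq α] {M : Matroid α} [M.Finite]

omit [DecidableEq α] [M.Finite] in
/-- If `x ∈ E` and `ρ(insert x X) ≤ ρ(X) < ⊤` then `x ∈ cl X`. -/
theorem mem_closure_of_eRk_insert_le {x : α} {X : Set α} (hx : x ∈ M.E) (hfin : M.eRk X ≠ ⊤)
    (h : M.eRk (insert x X) ≤ M.eRk X) : x ∈ M.closure X := by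
  by_contra hcl
  have := M.eRk_insert_eq_add_one ⟨hx, hcl⟩
  rw [this] at h
  exact absurd h (by
    intro h'
    have := (ENat.add_one_le_iff hfin).1 (le_of_eq rfl |>.trans h')
    exact lt_irrefl _ this)

omit [DecidableEq α] in
/-- In a loopless matroid, a rank-`1` set `B ∋ x` lies in `cl {x}`. -/
theorem subset_closure_singleton_of_eRk_one (hl : ∀ x ∈ M.E, M.IsNonloop x) {B : Finset α} (hB : B ⊆ gr M)
    (h1 : M.eRk (B : Set α) = 1) {x : α} (hx : x ∈ B) : (B : Set α) ⊆ M.closure {x} := by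
  intro y hy
  have hyE : y ∈ M.E := by rw [← coe_gr]; exact_mod_cast hB hy
  have hxE : x ∈ M.E := by rw [← coe_gr]; exact_mod_cast hB hx
  apply mem_closure_of_eRk_insert_le hyE (by rw [← lt_top_iff_ne_top]; exact (M.isRkFinite_set _).eRk_lt_top)
  rw [(hl x hxE).eRk_eq]
  have hxy : ({y, x} : Set α) ⊆ (B : Set α) := by
    intro z hz; rw [Set.mem_insert_iff, Set.mem_singleton_iff] at hz
    rcases hz with rfl | rfl
    · exact hy
    · exact hx
  calc M.eRk (insert y ({x} : Set α)) ≤ M.eRk (B : Set α) := M.eRk_mono hxy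
    _ = 1 := h1

open scoped Classical in
/-- The parallel class of `e` without `e`: the other points `x` with `e ∈ cl {x}`. -/
noncomputable def parClass (M : Matroid α) [M.Finite] (e : α) : Finset α :=
  ((gr M).erase e).filter (fun x => e ∈ M.closure {x})

open scoped Classical in
/-- Membership in the parallel class: `x ∈ E`, `x ≠ e` and `e ∈ cl {x}`. -/
theorem mem_parClass {e x : α} : x ∈ parClass M e ↔ x ∈ gr M ∧ x ≠ e ∧ e ∈ M.closure {x} := by
  unfold parClass
  rw [Finset.mem_filter, Finset.mem_erase]
  tauto

/-- A set `B ⊆ E ∖ {e}` with `e ∉ cl((E ∖ e) ∖ B)` contains the parallel class of `e`. -/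
theorem parClass_subset_of_notMem_closure {e : α} {B : Finset α}
    (hcl : e ∉ M.closure ((M.E \ {e}) \ (B : Set α))) : parClass M e ⊆ B := by
  intro x hx
  rw [mem_parClass] at hx
  by_contra hxB
  apply hcl
  apply M.closure_subset_closure (Set.singleton_subset_iff.2 ?_) hx.2.2
  refine ⟨⟨by rw [← coe_gr]; exact_mod_cast hx.1, hx.2.1⟩, ?_⟩
  rw [Finset.mem_coe]; exact hxB

/-- The price of a set at `q = 1` in terms of the rank of its complement. -/
theorem price_one_eq (N : Matroid α) [N.Finite] (u : ℕ) (B : Finset α) :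
    Profile.price N 1 u B = P1 (N.eRk ((gr N \ B : Finset α) : Set α)).toNat u := by
  have hfin : N.eRk ((gr N \ B : Finset α) : Set α) ≠ ⊤ := by
    rw [← lt_top_iff_ne_top]; exact (N.isRkFinite_set _).eRk_lt_top
  unfold Profile.price P1
  rw [← ENat.coe_toNat hfin, ENat.toNat_coe, Nat.choose_one_right]
  by_cases hu : u ≤ (N.eRk ((gr N \ B : Finset α) : Set α)).toNat
  · rw [if_pos (by exact_mod_cast hu), if_pos hu]; push_cast; rfl
  · rw [if_neg (by exact_mod_cast hu), if_neg hu]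

/-- The price of a set at `q = 0` in terms of the rank of its complement. -/
theorem price_zero_eq (N : Matroid α) [N.Finite] (v : ℕ) (B : Finset α) :
    Profile.price N 0 v B = P0 (N.eRk ((gr N \ B : Finset α) : Set α)).toNat v := by
  have hfin : N.eRk ((gr N \ B : Finset α) : Set α) ≠ ⊤ := by
    rw [← lt_top_iff_ne_top]; exact (N.isRkFinite_set _).eRk_lt_top
  unfold Profile.price P0
  rw [← ENat.coe_toNat hfin, ENat.toNat_coe]
  simp only [add_zero, Nat.choose_zero_right, Nat.cast_one, div_one]
  by_cases hv : v ≤ (N.eRk ((gr N \ B : Finset α) : Set α)).toNat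
  · rw [if_pos (by exact_mod_cast hv), if_pos hv]
  · rw [if_neg (by exact_mod_cast hv), if_neg hv]

/-- For `B ⊆ E ∖ {e}`: the complement of `B` in `E` is `insert e` of its complement in `E ∖ {e}`. -/
theorem coe_sdiff_eq_insert {e : α} {B : Finset α} (hB : B ⊆ (gr M).erase e) (heE : e ∈ gr M) :
    ((gr M \ B : Finset α) : Set α) = insert e ((M.E \ {e}) \ (B : Set α)) := by
  have heB : e ∉ B := fun h => (Finset.mem_erase.1 (hB h)).1 rfl
  ext x
  simp only [Finset.coe_sdiff, coe_gr, Set.mem_sdiff, Finset.mem_coe, Set.mem_insert_iff, Set.mem_singleton_iff]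
  constructor
  · rintro ⟨hx, hxB⟩
    by_cases hxe : x = e
    · exact Or.inl hxe
    · exact Or.inr ⟨⟨hx, hxe⟩, hxB⟩
  · rintro (rfl | ⟨⟨hx, _⟩, hxB⟩)
    · exact ⟨by rw [← coe_gr]; exact_mod_cast heE, heB⟩
    · exact ⟨hx, hxB⟩

/-- For `B ⊆ E ∖ {e}`: the complement of `B` in `E ∖ {e}` (as the ground of `M ＼ {e}` or `M ／ {e}`). -/
theorem coe_erase_sdiff {e : α} (B : Finset α) :
    (((gr M).erase e \ B : Finset α) : Set α) = (M.E \ {e}) \ (B : Set α) := by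
  rw [Finset.coe_sdiff, Finset.coe_erase, coe_gr]

/-- For `B ⊆ E ∖ {e}`: the complement of `insert e B` in `E` is the complement of `B` in `E ∖ {e}`. -/
theorem coe_sdiff_insert {e : α} (B : Finset α) :
    ((gr M \ insert e B : Finset α) : Set α) = (M.E \ {e}) \ (B : Set α) := by
  ext x
  simp only [Finset.coe_sdiff, coe_gr, Set.mem_sdiff, Finset.mem_coe, Finset.mem_insert, Set.mem_singleton_iff, not_or]
  tauto

/-- If `e ∉ cl((E∖e)∖B)` for a rank-`1` set `B ⊆ E ∖ e` of a loopless matroid with `e ∥ f`, then `B = parClass M e`. -/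
theorem eq_parClass_of_eRk_one (hl : ∀ x ∈ M.E, M.IsNonloop x) {e f : α} (hfE : f ∈ M.E) (hfe : f ≠ e)
    (hef : e ∈ M.closure {f}) {B : Finset α} (hB : B ⊆ (gr M).erase e) (h1 : M.eRk (B : Set α) = 1)
    (hcl : e ∉ M.closure ((M.E \ {e}) \ (B : Set α))) : B = parClass M e := by
  have hBE : (B : Set α) ⊆ M.E \ {e} := by
    intro x hx
    rw [Finset.mem_coe] at hx
    exact ⟨by rw [← coe_gr]; exact_mod_cast (Finset.mem_erase.1 (hB hx)).2, by rw [Set.mem_singleton_iff]; exact (Finset.mem_erase.1 (hB hx)).1⟩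
  have hBg : B ⊆ gr M := hB.trans (Finset.erase_subset _ _)
  apply Finset.Subset.antisymm _ (parClass_subset_of_notMem_closure hcl)
  intro x hx
  rw [mem_parClass]
  refine ⟨hBg hx, (Finset.mem_erase.1 (hB hx)).1, ?_⟩
  have heB : e ∈ M.closure (B : Set α) := by
    rcases spans_of_parallel hfE hfe hef (B : Set α) hBE with h | h
    · exact h
    · exact absurd h hcl
  have hsub := subset_closure_singleton_of_eRk_one hl hBg h1 hx
  exact M.closure_subset_closure_of_subset_closure hsub heB

/-- The parallel class contains `f`, is a rank-`1` set of `M ＼ {e}`, and a rank-`0` set of `M ／ {e}`. -/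
theorem parClass_facts (hl : ∀ x ∈ M.E, M.IsNonloop x) {e f : α} (hfE : f ∈ M.E) (hfe : f ≠ e)
    (hef : e ∈ M.closure {f}) (he : M.Indep {e}) :
    parClass M e ⊆ (gr M).erase e ∧ M.eRk ((parClass M e : Finset α) : Set α) = 1 ∧
      (M ／ ({e} : Set α)).eRk ((parClass M e : Finset α) : Set α) = 0 := by
  have heE : e ∈ M.E := he.subset_ground (Set.mem_singleton e)
  have hsub : parClass M e ⊆ (gr M).erase e := by
    intro x hx; rw [mem_parClass] at hx; exact Finset.mem_erase.2 ⟨hx.2.1, hx.1⟩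
  have hf : f ∈ parClass M e := by
    rw [mem_parClass]; exact ⟨by rw [← Finset.mem_coe, coe_gr]; exact hfE, hfe, hef⟩
  -- every member lies in cl {e}: rank of insert e (parClass) is 1
  have hPcl : ((parClass M e : Finset α) : Set α) ⊆ M.closure {e} := by
    intro x hx
    rw [Finset.mem_coe, mem_parClass] at hx
    exact (hl e heE).mem_closure_singleton hx.2.2
  have hins : M.eRk (insert e ((parClass M e : Finset α) : Set α)) = 1 := by
    have h1 : M.eRk (insert e ((parClass M e : Finset α) : Set α)) ≤ M.eRk (M.closure {e}) :=
      M.eRk_mono (Set.insert_subset (M.mem_closure_of_mem' (Set.mem_singleton e) heE) hPcl)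
    rw [M.eRk_closure_eq, (hl e heE).eRk_eq] at h1
    apply le_antisymm h1
    have h2 : M.eRk ({e} : Set α) ≤ M.eRk (insert e ((parClass M e : Finset α) : Set α)) :=
      M.eRk_mono (Set.singleton_subset_iff.2 (Set.mem_insert e _))
    rw [(hl e heE).eRk_eq] at h2
    exact h2
  refine ⟨hsub, ?_, ?_⟩
  · apply le_antisymm
    · calc M.eRk ((parClass M e : Finset α) : Set α) ≤ M.eRk (insert e ((parClass M e : Finset α) : Set α)) :=
            M.eRk_mono (Set.subset_insert _ _)
        _ = 1 := hins
    · have hfE' : f ∈ parClass M e := hf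
      have := M.eRk_mono (Set.singleton_subset_iff.2 (by rw [Finset.mem_coe]; exact hfE' : f ∈ ((parClass M e : Finset α) : Set α)))
      rw [(hl f hfE).eRk_eq] at this
      exact this
  · have hPE : ((parClass M e : Finset α) : Set α) ⊆ M.E \ {e} := by
      intro x hx; rw [Finset.mem_coe, mem_parClass] at hx
      exact ⟨by rw [← coe_gr]; exact_mod_cast hx.1, by rw [Set.mem_singleton_iff]; exact hx.2.1⟩
    have h := contract_singleton_eRk_add_one he hPE
    rw [hins] at h
    have h' : (M ／ ({e} : Set α)).eRk ((parClass M e : Finset α) : Set α) + 1 = (0 : ℕ∞) + 1 := by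
      rw [h, zero_add]
    exact WithTop.add_right_cancel (ENat.coe_ne_top 1) h'

/-- The price in `M ＼ {e}` of `B ⊆ E ∖ e` in terms of `ρ_M((E∖e)∖B)`. -/
theorem price_delete_one_eq (e : α) (u : ℕ) (B : Finset α) :
    Profile.price (M ＼ ({e} : Set α)) 1 u B = P1 (M.eRk ((M.E \ {e}) \ (B : Set α))).toNat u := by
  rw [price_one_eq, gr_delete_singleton'', coe_erase_sdiff, delete_singleton_eRk_eq Set.sdiff_subset]

/-- The price in `M ／ {e}` of `B ⊆ E ∖ e` at `q = 0`. -/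
theorem price_contract_zero_eq (e : α) (v : ℕ) (B : Finset α) :
    Profile.price (M ／ ({e} : Set α)) 0 v B = P0 ((M ／ ({e} : Set α)).eRk ((M.E \ {e}) \ (B : Set α))).toNat v := by
  rw [price_zero_eq, gr_contract_singleton, coe_erase_sdiff]

/-- The price in `M` of `insert e B` (`B ⊆ E ∖ e`) in terms of `ρ_M((E∖e)∖B)`. -/
theorem price_insert_one_eq (e : α) (u : ℕ) (B : Finset α) :
    Profile.price M 1 u (insert e B) = P1 (M.eRk ((M.E \ {e}) \ (B : Set α))).toNat u := by
  rw [price_one_eq, coe_sdiff_insert]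

/-- The price in `M` of `B ⊆ E ∖ e` in terms of `ρ_M((E∖e)∖B)` and whether `e ∈ cl((E∖e)∖B)`. -/
theorem price_one_eq_of_subset_erase {e : α} (heE : e ∈ gr M) (u : ℕ) {B : Finset α} (hB : B ⊆ (gr M).erase e) :
    Profile.price M 1 u B =
      P1 (M.eRk (insert e ((M.E \ {e}) \ (B : Set α)))).toNat u := by
  rw [price_one_eq, coe_sdiff_eq_insert hB heE]

/-- (L2): for every `B ⊆ E ∖ e`, the `M`-price of `insert e B` at level `u+1` is at most the `M ／ e`-price of `B`
at level `u`. -/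
theorem price_insert_le_price_contract {e : α} (he : M.Indep {e}) (u : ℕ) (B : Finset α) :
    Profile.price M 1 (u + 1) (insert e B) ≤ Profile.price (M ／ ({e} : Set α)) 0 u B := by
  rw [price_insert_one_eq, price_contract_zero_eq]
  have hsub : (M.E \ {e}) \ (B : Set α) ⊆ M.E \ {e} := Set.sdiff_subset
  have h := contract_singleton_eRk_add_one he hsub
  -- ρ_{M/e}(X) + 1 = ρ_M(insert e X) ≥ ρ_M(X)
  have hfin : M.eRk ((M.E \ {e}) \ (B : Set α)) ≠ ⊤ := by
    rw [← lt_top_iff_ne_top]; exact (M.isRkFinite_set _).eRk_lt_top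
  have hfinc : (M ／ ({e} : Set α)).eRk ((M.E \ {e}) \ (B : Set α)) ≠ ⊤ := by
    rw [← lt_top_iff_ne_top]; exact ((M ／ ({e} : Set α)).isRkFinite_set _).eRk_lt_top
  have hge : M.eRk ((M.E \ {e}) \ (B : Set α)) ≤ (M ／ ({e} : Set α)).eRk ((M.E \ {e}) \ (B : Set α)) + 1 := by
    rw [h]; exact M.eRk_mono (Set.subset_insert _ _)
  set r1 := (M.eRk ((M.E \ {e}) \ (B : Set α))).toNat with hr1
  set rc := ((M ／ ({e} : Set α)).eRk ((M.E \ {e}) \ (B : Set α))).toNat with hrc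
  have hge' : r1 ≤ rc + 1 := by
    rw [← ENat.coe_toNat hfin, ← ENat.coe_toNat hfinc] at hge
    exact_mod_cast hge
  calc P1 r1 (u + 1) ≤ P0 (r1 - 1) u := P1_le_P0 r1 u
    _ ≤ P0 rc u := P0_mono (by omega) u

/-- (L1): for `B ⊆ E ∖ e` with `e ∈ cl((E∖e)∖B)`, the `M`-price and the `M ＼ e`-price agree. -/
theorem price_eq_price_delete_of_mem_closure {e : α} (heE : e ∈ gr M) (u : ℕ) {B : Finset α}
    (hB : B ⊆ (gr M).erase e) (hcl : e ∈ M.closure ((M.E \ {e}) \ (B : Set α))) :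
    Profile.price M 1 u B = Profile.price (M ＼ ({e} : Set α)) 1 u B := by
  rw [price_one_eq_of_subset_erase heE u hB, price_delete_one_eq,
    eRk_insert_eq_of_mem_closure (Set.sdiff_subset.trans Set.sdiff_subset) hcl]

/-- (L3): for every `B ⊆ E ∖ e`: `price_M(B) + price_M(insert e B) ≤ price_{M＼e}(B) + price_{M／e}(B)` (levels `u+1` / `u`). -/
theorem price_pair_le {e : α} (he : M.Indep {e}) (u : ℕ) {B : Finset α} (hB : B ⊆ (gr M).erase e) :
    Profile.price M 1 (u + 1) B + Profile.price M 1 (u + 1) (insert e B) ≤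
      Profile.price (M ＼ ({e} : Set α)) 1 (u + 1) B + Profile.price (M ／ ({e} : Set α)) 0 u B := by
  have heE : e ∈ gr M := by rw [← Finset.mem_coe, coe_gr]; exact he.subset_ground (Set.mem_singleton e)
  rw [price_one_eq_of_subset_erase heE _ hB, price_insert_one_eq, price_delete_one_eq, price_contract_zero_eq]
  have hsub : (M.E \ {e}) \ (B : Set α) ⊆ M.E \ {e} := Set.sdiff_subset
  have h := contract_singleton_eRk_add_one he hsub
  have hfinc : (M ／ ({e} : Set α)).eRk ((M.E \ {e}) \ (B : Set α)) ≠ ⊤ := by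
    rw [← lt_top_iff_ne_top]; exact ((M ／ ({e} : Set α)).isRkFinite_set _).eRk_lt_top
  have hfinI : M.eRk (insert e ((M.E \ {e}) \ (B : Set α))) ≠ ⊤ := by
    rw [← lt_top_iff_ne_top]; exact (M.isRkFinite_set _).eRk_lt_top
  set rI := (M.eRk (insert e ((M.E \ {e}) \ (B : Set α)))).toNat with hrI
  set rc := ((M ／ ({e} : Set α)).eRk ((M.E \ {e}) \ (B : Set α))).toNat with hrc
  have hrel : rc + 1 = rI := by
    have : ((rc + 1 : ℕ) : ℕ∞) = (rI : ℕ∞) := by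
      push_cast
      rw [hrc, hrI, ENat.coe_toNat hfinc, ENat.coe_toNat hfinI]
      exact h
    exact_mod_cast this
  have key : P1 rI (u + 1) ≤ P0 rc u := by
    have := P1_le_P0 rI u
    rw [show rI - 1 = rc by omega] at this
    exact this
  linarith [key]

/-- The parallel class is in both index families. -/
theorem parClass_mem (hl : ∀ x ∈ M.E, M.IsNonloop x) {e f : α} (hfE : f ∈ M.E) (hfe : f ≠ e)
    (hef : e ∈ M.closure {f}) (he : M.Indep {e}) :
    parClass M e ∈ Profile.Rq (M ＼ ({e} : Set α)) 1 ∧ parClass M e ∈ Profile.Rq (M ／ ({e} : Set α)) 0 := by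
  obtain ⟨hsub, h1, h0⟩ := parClass_facts hl hfE hfe hef he
  have hPE : ((parClass M e : Finset α) : Set α) ⊆ M.E \ {e} := by
    intro x hx; rw [Finset.mem_coe] at hx
    have := hsub hx; rw [Finset.mem_erase] at this
    exact ⟨by rw [← coe_gr]; exact_mod_cast this.2, by rw [Set.mem_singleton_iff]; exact this.1⟩
  constructor
  · rw [Profile.mem_Rq, gr_delete_singleton'']
    refine ⟨hsub, ?_⟩
    rw [delete_singleton_eRk_eq hPE, h1]; rfl
  · rw [Profile.mem_Rq, gr_contract_singleton]
    exact ⟨hsub, by rw [h0]; rfl⟩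

/-- **The parallel-pair step for `(Π_{1,u})`**: for a loopless matroid with `e ∥ f`, `(Π_{1,u+1})` on `M ＼ {e}` gives
`(Π_{1,u+1})` on `M` (the rank-`0` statement on `M ／ {e}` is `profileIneq_zero`). -/
theorem profileIneq_one_of_delete_parallel (hl : ∀ x ∈ M.E, M.IsNonloop x) {e f : α} (hfE : f ∈ M.E) (hfe : f ≠ e)
    (hef : e ∈ M.closure {f}) (u : ℕ) (h : Profile.ProfileIneq (M ＼ ({e} : Set α)) 1 (u + 1)) :
    Profile.ProfileIneq M 1 (u + 1) := by
  classical
  have heE : e ∈ M.E := M.closure_subset_ground _ hef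
  have he : M.Indep {e} := M.indep_singleton.2 (hl e heE)
  have heg : e ∈ gr M := by rw [← Finset.mem_coe, coe_gr]; exact heE
  have hz := profileIneq_zero (M := M ／ ({e} : Set α)) u
  unfold Profile.ProfileIneq at h hz ⊢
  -- split the rank-1 sets of M by e ∈ B
  rw [← Finset.sum_filter_add_sum_filter_not (Profile.Rq M 1) (fun B => e ∈ B)]
  have hS1 : (Profile.Rq M 1).filter (fun B => ¬ e ∈ B) = Profile.Rq (M ＼ ({e} : Set α)) 1 :=
    filter_notMem_levelSet_eq e 1
  have hS0 : ((Profile.Rq M 1).filter (fun B => e ∈ B)).image (fun B => B.erase e) = Profile.Rq (M ／ ({e} : Set α)) 0 :=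
    image_erase_filter_mem_levelSet_eq he 0
  have hsum0 : ∑ B ∈ (Profile.Rq M 1).filter (fun B => e ∈ B), Profile.price M 1 (u + 1) B =
      ∑ B' ∈ Profile.Rq (M ／ ({e} : Set α)) 0, Profile.price M 1 (u + 1) (insert e B') := by
    rw [← hS0, Finset.sum_image (erase_injOn_filter_mem _ e)]
    apply Finset.sum_congr rfl
    intro B hB
    rw [Finset.insert_erase (Finset.mem_filter.1 hB).2]
  rw [hsum0, hS1]
  -- membership of the parallel class in both families
  obtain ⟨hP1, hP0⟩ := parClass_mem hl hfE hfe hef he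
  have hPsub : parClass M e ⊆ (gr M).erase e := (parClass_facts hl hfE hfe hef he).1
  -- off the parallel class, the M-price equals the M＼e-price; on the contraction side every term is bounded
  have hoff : ∀ B ∈ (Profile.Rq (M ＼ ({e} : Set α)) 1).erase (parClass M e),
      Profile.price M 1 (u + 1) B = Profile.price (M ＼ ({e} : Set α)) 1 (u + 1) B := by
    intro B hB
    rw [Finset.mem_erase] at hB
    have hB' := hB.2
    rw [Profile.mem_Rq, gr_delete_singleton''] at hB'
    have hBE : (B : Set α) ⊆ M.E \ {e} := by
      intro x hx; rw [Finset.mem_coe] at hx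
      have := hB'.1 hx; rw [Finset.mem_erase] at this
      exact ⟨by rw [← coe_gr]; exact_mod_cast this.2, by rw [Set.mem_singleton_iff]; exact this.1⟩
    have h1 : M.eRk (B : Set α) = 1 := by rw [← delete_singleton_eRk_eq hBE]; exact_mod_cast hB'.2
    by_cases hcl : e ∈ M.closure ((M.E \ {e}) \ (B : Set α))
    · exact price_eq_price_delete_of_mem_closure heg _ hB'.1 hcl
    · exact absurd (eq_parClass_of_eRk_one hl hfE hfe hef hB'.1 h1 hcl) hB.1
  have hpair := price_pair_le he u hPsub
  have hlev := card_levelSet_of_indep_singleton he u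
  -- assemble
  have hA : ∑ B ∈ Profile.Rq (M ＼ ({e} : Set α)) 1, Profile.price M 1 (u + 1) B =
      Profile.price M 1 (u + 1) (parClass M e) +
        ∑ B ∈ (Profile.Rq (M ＼ ({e} : Set α)) 1).erase (parClass M e), Profile.price (M ＼ ({e} : Set α)) 1 (u + 1) B := by
    rw [← Finset.add_sum_erase _ _ hP1, Finset.sum_congr rfl hoff]
  have hB : ∑ B' ∈ Profile.Rq (M ／ ({e} : Set α)) 0, Profile.price M 1 (u + 1) (insert e B') ≤
      Profile.price M 1 (u + 1) (insert e (parClass M e)) +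
        ∑ B' ∈ (Profile.Rq (M ／ ({e} : Set α)) 0).erase (parClass M e), Profile.price (M ／ ({e} : Set α)) 0 u B' := by
    rw [← Finset.add_sum_erase _ _ hP0]
    gcongr
    exact price_insert_le_price_contract he u _
  have hC : ∑ B ∈ Profile.Rq (M ＼ ({e} : Set α)) 1, Profile.price (M ＼ ({e} : Set α)) 1 (u + 1) B =
      Profile.price (M ＼ ({e} : Set α)) 1 (u + 1) (parClass M e) +
        ∑ B ∈ (Profile.Rq (M ＼ ({e} : Set α)) 1).erase (parClass M e), Profile.price (M ＼ ({e} : Set α)) 1 (u + 1) B :=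
    (Finset.add_sum_erase _ _ hP1).symm
  have hD : ∑ B' ∈ Profile.Rq (M ／ ({e} : Set α)) 0, Profile.price (M ／ ({e} : Set α)) 0 u B' =
      Profile.price (M ／ ({e} : Set α)) 0 u (parClass M e) +
        ∑ B' ∈ (Profile.Rq (M ／ ({e} : Set α)) 0).erase (parClass M e), Profile.price (M ／ ({e} : Set α)) 0 u B' :=
    (Finset.add_sum_erase _ _ hP0).symm
  rw [hlev]
  push_cast
  linarith [hA, hB, hC, hD, hpair, h, hz]

end Parallel

end PercRepro
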